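import Literature.NumberTheory.EllipticCurves.PAdicPowerSeriesZeros
import HarnessLib

set_option autoImplicit false

/-!
# AUG engine, step 11: SEPARATION with finitely many exceptions — an element of `Λ ⊗ ℚ_p` with infinitely many zeros in the
# open unit disc of `ℂ_p` is `0`; two elements with the same value at infinitely many points are equal
# (seat `bsd-cm-prr-ty1` g14, cell `bsd-cm`; theorems only: no definition, no named fact, no instance, no `sorry`)

Part 53 of the seat's kernel cut of stub 3 (cruxes stmt-BirchSwinnertonDyer-19945 / -19223).  The successor's ENDGAME (c) (HOME
`bsd-cm-prr-ty1/STUB3-CUT.md` §6 addendum 7) compares the Iwasawa functions `e·F·𝒞₁` and `[σ_α]·G·𝒞₂` through the identities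
(★χ) at the character points `ζ_χ − 1`, available for all but FINITELY MANY characters `χ` of `Γ` (Rohrlich: `L(f, χ, 1) ≠ 0`
cofinitely; the levels below the coherence threshold of `a_m`).  The tree's uniqueness principle
`MemIwasawaRat.eq_of_forall_hasSum` / `eq_zero_of_forall_hasSum_zero` (`PAdicPowerSeriesZeros`,
`PAdicPowerSeriesInterpolationAgreementProofs`) asks for agreement at ALL primitive even characters of all conductors `p^{k+3}`;
its engine `MemIwasawaRat.finite_setOf_hasSum_zero` (a non-zero element has finitely many zeros in the disc, `p`-adic
Weierstrass preparation) gives the cofinite form directly: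
* ★ `eq_zero_of_infinite_zeros` — `D ∈ Λ ⊗ ℚ_p` with `{z : ‖z‖ < 1, D(z) = 0}` infinite is `0`;
* ★ `eq_of_infinite_agree` — `G, H ∈ Λ ⊗ ℚ_p` agreeing (common `HasSum` value) on an infinite set of points of the disc are equal.
HONEST LABEL: a corollary of the tree's Weierstrass-preparation theorem; AUG displayed; no stub closed; nothing asserted on 19945 /
19223; BSD is not proved for any curve.
References: [Lang1990] Ch. 5 §2 Thm. 2.2; [Washington1997] Thm. 7.3; [MazurTateTeitelbaum1986Invent] §I.12–I.14.
-/

noncomputable section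

open Literature.NumberTheory.EllipticCurves

namespace Summit.BirchSwinnertonDyer.Rank1Residual.Additive.PerrinRiouUnit

variable {p : ℕ} [Fact p.Prime]

/-- ★ **An element of `Λ ⊗ ℚ_p` with infinitely many zeros in the open unit disc of `ℂ_p` is zero.**
[cite: Lang1990, Ch. 5 §2 Thm. 2.2] [cite: Washington1997, Thm. 7.3] -/
theorem eq_zero_of_infinite_zeros {D : PowerSeries ℚ_[p]} (hD : MemIwasawaRat p D)
    (h : {z : ℂ_[p] | ‖z‖ < 1 ∧
      HasSum (fun k ↦ algebraMap ℚ_[p] ℂ_[p] (PowerSeries.coeff k D) * z ^ k) 0}.Infinite) : D = 0 := by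
  by_contra hD0
  exact h (hD.finite_setOf_hasSum_zero hD0)

/-- ★ **Two elements of `Λ ⊗ ℚ_p` with the same value at infinitely many points of the open unit disc are equal**: if `S` is an
infinite set of points `z`, `‖z‖ < 1`, at each of which the evaluation series of `G` and `H` have a common sum, then `G = H`.
[cite: MazurTateTeitelbaum1986Invent, §I.12–I.14] [cite: Lang1990, Ch. 5 §2 Thm. 2.2] -/
theorem eq_of_infinite_agree {G H : PowerSeries ℚ_[p]} (hG : MemIwasawaRat p G) (hH : MemIwasawaRat p H)
    {S : Set ℂ_[p]} (hS : S.Infinite)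
    (h : ∀ z ∈ S, ‖z‖ < 1 ∧ ∃ v : ℂ_[p],
      HasSum (fun k ↦ algebraMap ℚ_[p] ℂ_[p] (PowerSeries.coeff k G) * z ^ k) v ∧
        HasSum (fun k ↦ algebraMap ℚ_[p] ℂ_[p] (PowerSeries.coeff k H) * z ^ k) v) :
    G = H := by
  refine sub_eq_zero.mp (eq_zero_of_infinite_zeros (hG.sub hH) (hS.mono fun z hz => ?_))
  obtain ⟨hz1, v, hvG, hvH⟩ := h z hz
  refine ⟨hz1, ?_⟩
  have hsub := hvG.sub hvH
  rw [sub_self] at hsub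
  have hfun : (fun k ↦ algebraMap ℚ_[p] ℂ_[p] (PowerSeries.coeff k (G - H)) * z ^ k) =
      fun k ↦ algebraMap ℚ_[p] ℂ_[p] (PowerSeries.coeff k G) * z ^ k -
        algebraMap ℚ_[p] ℂ_[p] (PowerSeries.coeff k H) * z ^ k := by
    funext k
    rw [map_sub, map_sub, sub_mul]
  rw [hfun]
  exact hsub

end Summit.BirchSwinnertonDyer.Rank1Residual.Additive.PerrinRiouUnit

end
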